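import Summits.BirchSwinnertonDyer.BirchSwinnertonDyer.Theorems.EisensteinPrimesUnrSelmerQuotientCorankLocalLambda
import Summits.BirchSwinnertonDyer.BirchSwinnertonDyer.Theorems.EisensteinPrimesUnrSelmerImprimitiveLambdaShift
import Summits.BirchSwinnertonDyer.BirchSwinnertonDyer.Theorems.EisensteinPrimesCharGrSelmerLambdaRelaxation
import HarnessLib

/-!
# The `≤` HALF of the STRICT `S`-relaxation corank identity IN THE KERNEL —
# `corank_{ℤ_p}(H¹_{𝓕_Gr^S}/H¹_{𝓕_Gr}) ≤ Σ_{w∈S} λ(𝒫_w(θ))` — hence `= Σ λ(𝒫_w(θ))` and CGLS Prop. 1.2.5's λ-clause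
# `λ(𝔛_θ^S) = λ(𝔛_θ) + Σ_{w∈S} λ(𝒫_w(θ))` VERBATIM as a theorem modulo its module clause and its (eq:sur2)-corank clause BY NAME
# (cell `bsd-eis`, width seat `bsd-line-x2-p2` gen 8; crux 4 `BSDpOnCellC` stmt-BirchSwinnertonDyer-19034, line b1 v12 UNCHANGED)

WHY. This seat typed CGLS Prop. 1.2.5's λ-relaxation clause as the corank INEQUALITY
`prop125_characterGrSelmerDual_corank_ge` (`Σ_{w∈S} charLocalLambda ≤ zpCorank (H¹_{𝓕_Gr^S}/H¹_{𝓕_Gr})`, the consequence of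
Pollack–Weston's surjectivity (eq:sur2)), leaving `-- TODO(general form): … the equality of the corank with Σ λ(𝒫_w(θ))`. The
OTHER inequality needs no surjectivity: the quotient embeds into `∏_{w∈S} ∏_{η∣w} H¹(I_η, (F/𝒪)(θ))`, each factor of corank
`≤ 𝟙[θ unramified at w ∧ θ(Frob_w) ≡ Nw]` (Greenberg–Vatsal Prop. (2.4) recipe) — proved in the kernel by the x1 cell for the
UNRAMIFIED groups (`UnrSelmerQuotientCorankChar.zpCorank_unrSelmer_quotient_le_sum_of_loc`, LEAD x1-p1; per-place bound
`CharLocalInertiaFrobenius.zpCorank_le_ite_of_forall_exists`, x1-p1-w2). Here the STRICT version is deduced from it: the strict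
quotient `H¹_{𝓕_Gr^S}/H¹_{𝓕_Gr}` EMBEDS into the unramified one `H¹_{𝓕_nr^S}/H¹_{𝓕_nr}` (a class strict at `v̄` and unramified at `S`
is in `H¹_{𝓕_Gr}`: `H¹_{𝓕_Gr^S} ∩ H¹_{𝓕_nr} = H¹_{𝓕_Gr}`), so its corank is at most that of the unramified quotient.

WHAT.
* §1 `zpCorank_grSelmer_quotient_le_unrSelmer_quotient` — GENERIC discrete `p`-primary `M`, any `κ`, `vbar`, `S`:
  `corank_{ℤ_p}(gr^S/gr^∅) ≤ corank_{ℤ_p}(unr^S/unr^∅)` (when the latter quotient has finite `p`-torsion), via the injection induced by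
  `grSelmer ≤ unrSelmer` (`KellerYin2024.grSelmer_le_unrSelmer`) and `X2.NonPrimitiveQuotientCorank.zpCorank_le_of_injective`.
* §2 `zpCorank_grSelmer_quotient_le_sum_charLocalLambda` — CHARACTER level, any number field / `ℤ_p`-extension with topological
  generator: for `θ : Γ_K → GL₁(ℤ_p)` Teichmüller-valued and a finite set `Sf` of places `w ∤ p` finitely decomposed in `K_∞`
  (`hD`): `corank_{ℤ_p}(H¹_{𝓕_Gr^{Sf}}/H¹_{𝓕_Gr}) ≤ Σ_{w∈Sf} charLocalLambda ∅ κ θ w` (UNCONDITIONAL).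
* §3 `zpCorank_grSelmer_quotient_eq_sum_of_fact` — under the binders of `prop125_characterGrSelmerDual_corank_ge` plus `hD`:
  **`corank_{ℤ_p}(H¹_{𝓕_Gr^S}/H¹_{𝓕_Gr}) = Σ_{w∈S} λ(𝒫_w(θ))`** modulo that ONE named fact (its `TODO(general form)` equality).
* §4 at a NON-SPLIT multiplicative Eisenstein datum (binders of this seat's `CharGrSelmerLambdaRelaxation`):
  `charLambdaRelaxation_eq_of_not_split_of_facts` — **`λ(DS.X) = λ(D0.X) + Σ_{w∈Sf} charLocalLambda ∅ κ θ w`** for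
  `θ ∈ {θsub, θquot}` and ALL strict dual data = CGLS Prop. 1.2.5's displayed λ-clause VERBATIM, modulo its module/dimension clause
  (`prop125_characterGrSelmerDual_torsion_muZero_dim`, g6) + corank clause (this seat) BY NAME; and
  `lambdaInvariant_xAc_eq_add_add_sum_of_not_split_of_facts` — **`λ(𝔛^{Sf}_f) = λ(𝔛_{θsub}) + λ(𝔛_{θquot}) +
  Σ_{w∈Sf}(λ𝒫_w(θsub) + λ𝒫_w(θquot))`** (EQUALITY; g7's [ALG-imp] + [PWL-θ] both as identities), modulo PUBLISHED facts only
  (CGLS22 ×5 + Greenberg ×4).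

HONEST FRAMING: theorems only (no definition, no new named fact, no `sorry`); §1–§2 unconditional, §3–§4 conditional BY NAME on
PUBLISHED facts. Nothing here closes a stub of v12; the non-split wall's residual stays the ONE analytic sentence `hAN` of
`…BSDpOnCellCImprimitiveCountNonsplitOfFacts` (p659330). BSD / Mazur's MC / IMC proved for no curve; 0 cells / labels / tiers move.

References: [CastellaGrossiLeeSkinner2022] §1.1 Lemma 1.1.1, §1.2 Prop. 1.2.5 and proof (eq:sur1)–(eq:sur2) (Invent. Math. 227 (2022);
arXiv:2008.02571 Prop. 14); [GreenbergVatsal2000] §2 Cor. (2.3), Prop. (2.4) (pp. 20–23); [KellerYin2024] Prop. 1.2.5, Rem. 1.2.3,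
Lemma 1.1.1 (arXiv:2402.12781v2); [PollackWeston2011] Prop. A.2; [Brink2007] Thm. 2.
-/

set_option linter.dupNamespace false
set_option autoImplicit false

noncomputable section

open scoped Classical AddSubgroup

open WeierstrassCurve NumberField IsDedekindDomain Field
  Literature.NumberTheory.EllipticCurves Literature.NumberTheory.EllipticCurves.Castella2018
  Literature.NumberTheory.EllipticCurves.GreenbergSelmer
  Literature.NumberTheory.EllipticCurves.GreenbergVatsal2000 Literature.NumberTheory.GaloisRepresentations
  Literature.NumberTheory.EllipticCurves.KellerYin2024 Literature.NumberTheory.EllipticCurves.IwasawaAlgebra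
  Literature.NumberTheory.EllipticCurves.Castella2018.AcSelmer Literature.NumberTheory.EllipticCurves.Rank1Residual
  Literature.NumberTheory.EllipticCurves.CastellaGrossiLeeSkinner2022
  Literature.NumberTheory.IwasawaTheory Literature.NumberTheory.IwasawaTheory.Greenberg2016
  Literature.NumberTheory.IwasawaTheory.Greenberg2006
open Summit.BirchSwinnertonDyer.Rank1Residual.X2.NonPrimitiveQuotientCorank
  Summit.BirchSwinnertonDyer.BirchSwinnertonDyer.Theorems
  Summit.BirchSwinnertonDyer.BirchSwinnertonDyer.Theorems.IwasawaTwoVariable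
  Summit.BirchSwinnertonDyer.BirchSwinnertonDyer.Theorems.DatumSelmerQuotientTorsionFiniteGeneric
  Summit.BirchSwinnertonDyer.BirchSwinnertonDyer.Theorems.UnrSelmerQuotientTorsionFiniteChar
  Summit.BirchSwinnertonDyer.BirchSwinnertonDyer.Theorems.UnrSelmerQuotientCorankChar
  Summit.BirchSwinnertonDyer.BirchSwinnertonDyer.Theorems.CharLocalInertiaFrobenius

namespace Summit.BirchSwinnertonDyer.BirchSwinnertonDyer.Theorems.GrSelmerQuotientCorankLe

/-! ## §1 The strict quotient embeds into the unramified quotient (generic module) -/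

section Generic

variable {K : Type} [Field K] [NumberField K] {p : ℕ} [Fact p.Prime] (κ : ZpExtension K p)
  (M : Type) [AddCommGroup M] [DistribMulAction (absoluteGaloisGroup K) M] [TopologicalSpace M]
  [DiscreteTopology M] (vbar : HeightOneSpectrum (𝓞 K)) (S : Set (HeightOneSpectrum (𝓞 K)))

/-- **`H¹_{𝓕_Gr^S} ∩ H¹_{𝓕_nr} = H¹_{𝓕_Gr}`**: a class of the `S`-imprimitive STRICT group which lies in the primitive UNRAMIFIED group
lies in the primitive strict group (the strict conditions above `p` come from the first membership, unramifiedness at every place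
off `p` from the second). Bookkeeping on `mem_datumStrictSelmer_iff` / `mem_datumSelmer_iff`. [cite: GreenbergVatsal2000, §2 pp. 15, 20]
[cite: KellerYin2024, §1.2 Def. (1)–(4) (arXiv:2402.12781v2)] -/
theorem mem_grSelmer_empty_of_mem_unrSelmer_empty {c : subgroupH1 κ.kerSubgroup M}
    (hc : c ∈ grSelmer κ M vbar S) (hu : c ∈ unrSelmer κ M vbar (∅ : Set (HeightOneSpectrum (𝓞 K)))) :
    c ∈ grSelmer κ M vbar (∅ : Set (HeightOneSpectrum (𝓞 K))) := by
  have hc' : c ∈ datumStrictSelmer κ.kerSubgroup M p (AcSelmer.bdpData M p vbar) S := hc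
  have hu' : c ∈ datumSelmer κ.kerSubgroup M p (AcSelmer.bdpData M p vbar) (∅ : Set (HeightOneSpectrum (𝓞 K))) := hu
  obtain ⟨-, hstrict⟩ := (mem_datumStrictSelmer_iff c).1 hc'
  obtain ⟨hunr, -⟩ := (mem_datumSelmer_iff c).1 hu'
  exact (mem_datumStrictSelmer_iff c).2 ⟨hunr, hstrict⟩

/-- **`corank_{ℤ_p}(H¹_{𝓕_Gr^S}/H¹_{𝓕_Gr}) ≤ corank_{ℤ_p}(H¹_{𝓕_nr^S}/H¹_{𝓕_nr})`** for a GENERIC discrete `p`-primary `Γ_K`-module `M`,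
any `ℤ_p`-extension `κ`, any `vbar`, any `S` (granted the unramified quotient has finite `p`-torsion): the inclusion
`H¹_{𝓕_Gr^S} ≤ H¹_{𝓕_nr^S}` induces an INJECTION of the quotients (`mem_grSelmer_empty_of_mem_unrSelmer_empty`), and `zpCorank` is
monotone along injections into `p`-primary groups with finite `p`-torsion (`X2.NonPrimitiveQuotientCorank.zpCorank_le_of_injective`).
[cite: GreenbergVatsal2000, §2 pp. 15, 20 ("the kernel of γ'₀ is the strict Selmer group")] -/
theorem zpCorank_grSelmer_quotient_le_unrSelmer_quotient (htor : ∀ m : M, ∃ k : ℕ, p ^ k • m = 0)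
    [Finite ((↥(unrSelmer κ M vbar S) ⧸
      (unrSelmer κ M vbar (∅ : Set (HeightOneSpectrum (𝓞 K)))).addSubgroupOf (unrSelmer κ M vbar S))[(p : ℤ)])] :
    zpCorank (↥(grSelmer κ M vbar S) ⧸
        (grSelmer κ M vbar (∅ : Set (HeightOneSpectrum (𝓞 K)))).addSubgroupOf (grSelmer κ M vbar S)) p ≤
      zpCorank (↥(unrSelmer κ M vbar S) ⧸
        (unrSelmer κ M vbar (∅ : Set (HeightOneSpectrum (𝓞 K)))).addSubgroupOf (unrSelmer κ M vbar S)) p := by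
  have hle : grSelmer κ M vbar S ≤ unrSelmer κ M vbar S := grSelmer_le_unrSelmer κ M vbar S
  have hle0 : grSelmer κ M vbar (∅ : Set (HeightOneSpectrum (𝓞 K))) ≤ unrSelmer κ M vbar (∅ : Set (HeightOneSpectrum (𝓞 K))) :=
    grSelmer_le_unrSelmer κ M vbar _
  have hN : (grSelmer κ M vbar (∅ : Set (HeightOneSpectrum (𝓞 K)))).addSubgroupOf (grSelmer κ M vbar S) ≤
      ((unrSelmer κ M vbar (∅ : Set (HeightOneSpectrum (𝓞 K)))).addSubgroupOf (unrSelmer κ M vbar S)).comap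
        (AddSubgroup.inclusion hle) := fun s hs ↦ by
    rw [AddSubgroup.mem_comap, AddSubgroup.mem_addSubgroupOf, AddSubgroup.coe_inclusion]
    exact hle0 (AddSubgroup.mem_addSubgroupOf.1 hs)
  let f := QuotientAddGroup.map _ _ (AddSubgroup.inclusion hle) hN
  have hf : Function.Injective f := by
    rw [injective_iff_map_eq_zero]
    intro q hq
    induction q using QuotientAddGroup.induction_on with
    | H s =>
      rw [QuotientAddGroup.map_mk, QuotientAddGroup.eq_zero_iff, AddSubgroup.mem_addSubgroupOf,
        AddSubgroup.coe_inclusion] at hq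
      exact (QuotientAddGroup.eq_zero_iff s).2
        (AddSubgroup.mem_addSubgroupOf.2 (mem_grSelmer_empty_of_mem_unrSelmer_empty κ M vbar S s.2 hq))
  exact zpCorank_le_of_injective f hf (fun q ↦ UnrSelmerImprimitiveLambdaShift.isPrimary_quotient κ vbar htor q)

end Generic

/-! ## §2 Character level: `corank_{ℤ_p}(H¹_{𝓕_Gr^{Sf}}/H¹_{𝓕_Gr}) ≤ Σ_{w∈Sf} λ(𝒫_w(θ))`, UNCONDITIONAL -/

section Character

variable {K : Type} [Field K] [NumberField K] {p : ℕ} [Fact p.Prime]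

/-- **The `≤` half of the STRICT `S`-relaxation corank identity, IN THE KERNEL**: for ANY number field `K`, ANY `ℤ_p`-extension `κ`
with topological generator `γ`, any `vbar`, any character `θ : Γ_K → GL₁(ℤ_p)` with Teichmüller values (`θ^{p−1} = 1`), and a
finite set `Sf` of places `w ∤ p` each finitely decomposed in `K_∞` (`hD`):
`zpCorank (H¹_{𝓕_Gr^{Sf}}(K_∞, (F/𝒪)(θ)) / H¹_{𝓕_Gr}) p ≤ Σ_{w∈Sf} charLocalLambda ∅ κ θ w`. §1 + the x1 cell's unramified bound
(`zpCorank_unrSelmer_quotient_le_sum_of_loc` with the per-place constants `𝟙[FrobActsAsNormAt]` of `zpCorank_le_ite_of_forall_exists`;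
finiteness of the unramified quotient's `p`-torsion from `finite_torsionBy_quotient`). The `≥` half is the published input
(eq:sur2) = Pollack–Weston A.2 (`prop125_characterGrSelmerDual_corank_ge`).
[cite: CastellaGrossiLeeSkinner2022, Prop. 1.2.5 proof (eq:sur1)–(eq:sur2), Lemma 1.1.1 (arXiv:2008.02571 Prop. 14, Lemma 9)]
[cite: GreenbergVatsal2000, §2 Cor. (2.3), Prop. (2.4) (pp. 20–23)] [cite: KellerYin2024, Prop. 1.2.5, Lemma 1.1.1 (the 𝓕_nr twins)] -/
theorem zpCorank_grSelmer_quotient_le_sum_charLocalLambda (κ : ZpExtension K p)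
    {γ : absoluteGaloisGroup K} (hγ : κ.IsTopGenerator γ) (vbar : HeightOneSpectrum (𝓞 K))
    (θ : FramedGaloisRep K (padicCoeffIntegers (∅ : Set (PadicAlgCl p))) 1)
    (hθ : ∀ σ : absoluteGaloisGroup K, θ σ ^ (p - 1) = 1)
    (Sf : Finset (HeightOneSpectrum (𝓞 K))) (hSp : ∀ w ∈ Sf, ((p : ℕ) : 𝓞 K) ∉ w.asIdeal)
    (hD : ∀ w ∈ Sf, ∃ δ ∈ decomp (K := K) w, κ δ ≠ 1) :
    zpCorank (↥(grSelmer κ (charModule (∅ : Set (PadicAlgCl p)) θ) vbar (↑Sf : Set (HeightOneSpectrum (𝓞 K)))) ⧸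
        (grSelmer κ (charModule (∅ : Set (PadicAlgCl p)) θ) vbar (∅ : Set (HeightOneSpectrum (𝓞 K)))).addSubgroupOf
          (grSelmer κ (charModule (∅ : Set (PadicAlgCl p)) θ) vbar (↑Sf : Set (HeightOneSpectrum (𝓞 K))))) p ≤
      ∑ w ∈ Sf, charLocalLambda (∅ : Set (PadicAlgCl p)) κ θ w := by
  haveI := finite_torsionBy_charModule θ
  haveI : Finite ((↥(unrSelmer κ (charModule (∅ : Set (PadicAlgCl p)) θ) vbar (↑Sf : Set (HeightOneSpectrum (𝓞 K)))) ⧸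
      (unrSelmer κ (charModule (∅ : Set (PadicAlgCl p)) θ) vbar (∅ : Set (HeightOneSpectrum (𝓞 K)))).addSubgroupOf
        (unrSelmer κ (charModule (∅ : Set (PadicAlgCl p)) θ) vbar (↑Sf : Set (HeightOneSpectrum (𝓞 K)))))[(p : ℤ)]) :=
    finite_torsionBy_quotient κ (M := charModule (∅ : Set (PadicAlgCl p)) θ)
      ⟨1, by rw [natCard_torsionBy_charModule, pow_one]⟩ (exists_nsmul_eq_charModule θ)
      (isOpen_stabilizer_cofree (∅ : Set (PadicAlgCl p)) θ) hγ
      (AcSelmer.bdpData (charModule (∅ : Set (PadicAlgCl p)) θ) p vbar) Sf (fun w hw _ ↦ hD w hw)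
  have hunr := zpCorank_unrSelmer_quotient_le_sum_of_loc κ hγ vbar θ Sf hSp hD
    (fun w ↦ if FrobActsAsNormAt (∅ : Set (PadicAlgCl p)) θ w then 1 else 0)
    (fun w hw Y hY ↦ zpCorank_le_ite_of_forall_exists θ w κ hθ (hSp w hw) Y hY)
  have hgr := zpCorank_grSelmer_quotient_le_unrSelmer_quotient κ (charModule (∅ : Set (PadicAlgCl p)) θ) vbar
    (↑Sf : Set (HeightOneSpectrum (𝓞 K))) (exists_pow_smul_cofree_eq_zero (∅ : Set (PadicAlgCl p)) θ)
  calc _ ≤ _ := hgr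
    _ ≤ ∑ w ∈ Sf, numPlacesAbove κ w * (if FrobActsAsNormAt (∅ : Set (PadicAlgCl p)) θ w then 1 else 0) := hunr
    _ = ∑ w ∈ Sf, charLocalLambda (∅ : Set (PadicAlgCl p)) κ θ w := Finset.sum_congr rfl fun w _ ↦ rfl

/-! ## §3 The corank EQUALITY modulo the (eq:sur2)-clause by name -/

/-- **`corank_{ℤ_p}(H¹_{𝓕_Gr^S}/H¹_{𝓕_Gr}) = Σ_{w∈S} λ(𝒫_w(θ))`** — CGLS Prop. 1.2.5's proof's identification
`H¹_{F_Gr}^S/H¹_{F_Gr} ≅ ∏_{w∈S} H¹(K_w, M_θ)` read in `ℤ_p`-coranks with Lemma 1.1.1 — under the binders of the named fact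
`prop125_characterGrSelmerDual_corank_ge` (`p` odd, `K` imaginary quadratic, `(p)` split, `κ` anticyclotomic, `𝔭 = v̄ ∋ p`, `θ`
Teichmüller-valued, residual character unramified outside `S ∪ {w ∣ p}` with `S` prime-to-`p` over split rational primes, `D_𝔭` neither
trivial nor cyclotomic on `(F/𝒪)(θ)[p]`) plus a topological generator `γ` and the finitely-decomposed hypothesis `hD` at the places of
`S`: GRANTED that fact (`≥`, Pollack–Weston A.2) BY NAME, the `≤` half being §2. (The fact's `TODO(general form)` equality, modulo
the fact.) [cite: CastellaGrossiLeeSkinner2022, Prop. 1.2.5 and proof (eq:sur2), Lemma 1.1.1 (arXiv:2008.02571 Prop. 14)]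
[cite: PollackWeston2011, App. A Prop. A.2] [cite: GreenbergVatsal2000, §2 Cor. (2.3), Prop. (2.4)] -/
theorem zpCorank_grSelmer_quotient_eq_sum_of_fact (hge : prop125_characterGrSelmerDual_corank_ge)
    (K : Type) [Field K] [NumberField K] (hK : IsImaginaryQuadratic K) (hp2 : p ≠ 2)
    (hsplit : ((Ideal.span {(p : ℤ)}).primesOver (𝓞 K)).ncard = 2)
    (κ : ZpExtension K p) (hκ : κ.IsAnticyclotomic) {γ : absoluteGaloisGroup K} (hγ : κ.IsTopGenerator γ)
    (vbar : HeightOneSpectrum (𝓞 K)) (hvbar : ((p : ℕ) : 𝓞 K) ∈ vbar.asIdeal)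
    (θ : FramedGaloisRep K (padicCoeffIntegers (∅ : Set (PadicAlgCl p))) 1)
    (hθ : ∀ σ : absoluteGaloisGroup K, θ σ ^ (p - 1) = 1)
    (S : Finset (HeightOneSpectrum (𝓞 K)))
    (hSmem : ∀ v ∈ S, ((p : ℕ) : 𝓞 K) ∉ v.asIdeal ∧ ((v.asIdeal.under ℤ).primesOver (𝓞 K)).ncard = 2)
    (hunr : ∀ v : HeightOneSpectrum (𝓞 K), v ∉ S → ((p : ℕ) : 𝓞 K) ∉ v.asIdeal →
      ∀ x ∈ inertia v, ∀ m : charModule (∅ : Set (PadicAlgCl p)) θ, p • m = 0 → x • m = m)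
    (hne1 : ¬ ∀ g ∈ decomp vbar, ∀ m : charModule (∅ : Set (PadicAlgCl p)) θ, p • m = 0 → g • m = m)
    (hneω : ¬ ∀ g ∈ decomp vbar, ∀ m : charModule (∅ : Set (PadicAlgCl p)) θ, p • m = 0 →
      g • m = ((modNCyclotomicCharacter K p g : (ZMod p)ˣ) : ZMod p).val • m)
    (hD : ∀ w ∈ S, ∃ δ ∈ decomp (K := K) w, κ δ ≠ 1) :
    zpCorank (↥(grSelmer κ (charModule (∅ : Set (PadicAlgCl p)) θ) vbar (↑S : Set (HeightOneSpectrum (𝓞 K)))) ⧸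
        (grSelmer κ (charModule (∅ : Set (PadicAlgCl p)) θ) vbar (∅ : Set (HeightOneSpectrum (𝓞 K)))).addSubgroupOf
          (grSelmer κ (charModule (∅ : Set (PadicAlgCl p)) θ) vbar (↑S : Set (HeightOneSpectrum (𝓞 K))))) p =
      ∑ w ∈ S, charLocalLambda (∅ : Set (PadicAlgCl p)) κ θ w :=
  le_antisymm (zpCorank_grSelmer_quotient_le_sum_charLocalLambda κ hγ vbar θ hθ S (fun w hw ↦ (hSmem w hw).1) hD)
    (hge K p hK hp2 hsplit κ hκ vbar hvbar θ hθ S hSmem hunr hne1 hneω)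

/-! ## §4 At a NON-SPLIT multiplicative Eisenstein datum: CGLS Prop. 1.2.5's λ-clause VERBATIM, and [ALG-imp] + [PWL-θ] as an EQUALITY -/

/-- **CGLS Prop. 1.2.5's λ-clause `λ(𝔛_θ^S) = λ(𝔛_θ) + Σ_{w∈S} λ(𝒫_w(θ))` as a THEOREM modulo its module/dimension clause and its
corank clause BY NAME, at a NON-SPLIT multiplicative Eisenstein datum, for either residual character `θ ∈ {θsub, θquot}`** and ALL
strict dual data `DS` (at `Sf`), `D0` (at `∅`): `λ(DS.X) = λ(D0.X) + Σ_{w∈Sf} charLocalLambda ∅ κ θ w` (datum: `W/ℚ` globally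
minimal, `2 < p`, `p ‖ N` NON-SPLIT, `K` imaginary quadratic Heegner for `N_E`, `(p)` split, `v̄ ∋ p`, `κ` anticyclotomic with
generator `γ`, `Sf` = places over `N_E` off `p` — finitely decomposed in `K_∞` by Brink 2007, `exists_mem_decomp_apply_ne_one_of_heegner`).
This seat's `charLambdaRelaxation_of_not_split_of_facts` (λ-shift = corank) + §3 (corank = Σ). [cite: CastellaGrossiLeeSkinner2022, §1.2 Prop. 1.2.5 ("λ(𝔛_θ^S) = λ(𝔛_θ) + Σ_{w∈Σ, w∤p} λ(𝒫_w(θ))"; arXiv:2008.02571 Prop. 14)]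
[cite: KellerYin2024, Prop. 1.2.5, Lemma 5.1.1 (arXiv:2402.12781v2) (the 𝓕_nr twin; the datum)] [cite: Brink2007, Thm. 2] -/
theorem charLambdaRelaxation_eq_of_not_split_of_facts
    (hprop125 : prop125_characterGrSelmerDual_torsion_muZero_dim) (hge : prop125_characterGrSelmerDual_corank_ge)
    (W : WeierstrassCurve ℚ) [W.IsElliptic] [W.IsGloballyMinimal]
    (K : Type) [Field K] [NumberField K] (vbar : HeightOneSpectrum (𝓞 K))
    (κ : ZpExtension K p) (γ : absoluteGaloisGroup K) [hγ : Fact (κ.IsTopGenerator γ)]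
    (Sf : Finset (HeightOneSpectrum (𝓞 K)))
    (hp2 : 2 < p) (hmult : Mult W p) (hns : ¬ W.HasSplitMultiplicativeReductionAtPrime p)
    (hK : IsImaginaryQuadratic K) (hH : SatisfiesHeegnerHypothesis (W.conductorNorm ℤ) K)
    (hsplit : ((Ideal.span {(p : ℤ)}).primesOver (𝓞 K)).ncard = 2)
    (hvbar : ((p : ℕ) : 𝓞 K) ∈ vbar.asIdeal) (hκ : κ.IsAnticyclotomic)
    (hSf : ∀ w : HeightOneSpectrum (𝓞 K), w ∈ Sf ↔
      (((W.conductorNorm ℤ : ℤ) : 𝓞 K) ∈ w.asIdeal ∧ ((p : ℕ) : 𝓞 K) ∉ w.asIdeal))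
    (θsub θquot : FramedGaloisRep K (padicCoeffIntegers (∅ : Set (PadicAlgCl p))) 1)
    (hpair : IsResidualPairOver (W.baseChange K) p θsub θquot)
    (θ : FramedGaloisRep K (padicCoeffIntegers (∅ : Set (PadicAlgCl p))) 1) (hθ : θ = θsub ∨ θ = θquot)
    (DS : GrDualData κ (charModule (∅ : Set (PadicAlgCl p)) θ) vbar (↑Sf : Set (HeightOneSpectrum (𝓞 K))) γ)
    (D0 : GrDualData κ (charModule (∅ : Set (PadicAlgCl p)) θ) vbar (∅ : Set (HeightOneSpectrum (𝓞 K))) γ) :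
    lambdaInvariant p DS.X = lambdaInvariant p D0.X + ∑ w ∈ Sf, charLocalLambda (∅ : Set (PadicAlgCl p)) κ θ w := by
  have hp2' : p ≠ 2 := by omega
  obtain ⟨hSmem, hchar⟩ := CharGrSelmerLambdaRelaxation.charHypotheses_of_not_split W K vbar κ Sf hp2 hmult hns hK hH hsplit hvbar
    hSf θsub θquot hpair
  obtain ⟨hθT, hunr, hne1, hneω⟩ := hchar θ hθ
  obtain ⟨-, -, -, hlam, -⟩ := CharGrSelmerLambdaRelaxation.charLambdaRelaxation_of_not_split_of_facts hprop125 hge W K vbar κ γ Sf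
    hp2 hmult hns hK hH hsplit hvbar hκ hSf θsub θquot hpair θ hθ DS D0
  have hD : ∀ w ∈ Sf, ∃ δ ∈ decomp (K := K) w, κ δ ≠ 1 := fun w hw ↦
    exists_mem_decomp_apply_ne_one_of_heegner hK hp2 hH κ hκ w ((hSf w).mp hw).1 ((hSf w).mp hw).2
  rw [hlam, zpCorank_grSelmer_quotient_eq_sum_of_fact hge K hK hp2' hsplit κ hκ hγ.out vbar hvbar θ hθT Sf hSmem hunr hne1 hneω hD]

/-- **[ALG-imp] + [PWL-θ] as an EQUALITY at a NON-SPLIT multiplicative Eisenstein datum, modulo PUBLISHED facts BY NAME: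
`λ(𝔛^{Sf}_f) = λ(𝔛_{θsub}) + λ(𝔛_{θquot}) + Σ_{w∈Sf} (λ𝒫_w(θsub) + λ𝒫_w(θquot))`** — `𝔛^{Sf}_f = XAc E_K p κ v̄ ↑Sf γ`, `𝔛_θ = D0θ.X`
ANY strict dual data of the PRIMITIVE character Selmer groups, `λ𝒫_w(θ) = charLocalLambda ∅ κ θ w`; datum and the nine facts as in
g7's `XAcImprimitiveNoPTorsion.lambdaInvariant_xAc_eq_add_of_not_split_of_facts` + `prop125_characterGrSelmerDual_corank_ge`. CGLS
(eq:lambda-imp) ∘ Prop. 1.2.5; Keller–Yin Thm. 1.4.1 ∘ Prop. 1.2.5 (there at good `p`). Upgrades this seat's inequality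
`CharGrSelmerLambdaRelaxation.add_add_sum_le_lambdaInvariant_xAc_of_not_split_of_facts` to the identity.
[cite: CastellaGrossiLeeSkinner2022, §1.2 Prop. 1.2.5, §1.4, proof of Thm. 1.5.1 (eq:lambda-imp)] [cite: KellerYin2024, Thm. 1.4.1, Prop. 1.2.5 (arXiv:2402.12781v2)]
[cite: Greenberg2016Selmer, Prop. 4.1.1] [cite: Greenberg2006, Props. 3.2, 4.1, 4.2] -/
theorem lambdaInvariant_xAc_eq_add_add_sum_of_not_split_of_facts
    (hprop125 : prop125_characterGrSelmerDual_torsion_muZero_dim) (hge : prop125_characterGrSelmerDual_corank_ge)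
    (hfact : prop14_residualCharacterSelmer_finite)
    (hlift : cor126_residualCharacter_globalLift) (hlocal : cor126_residualCharacter_localSurjective)
    (h411 : prop411_selmer_isAlmostDivisible) (h41 : prop41_globalEulerPoincareCorank)
    (h42 : prop42_localEulerPoincareCorank) (h32 : prop32_cohomology_isCofinitelyGenerated)
    (W : WeierstrassCurve ℚ) [W.IsElliptic] [W.IsGloballyMinimal]
    (K : Type) [Field K] [NumberField K] {v : HeightOneSpectrum (𝓞 K)} (vbar : HeightOneSpectrum (𝓞 K))
    (κ : ZpExtension K p) (γ : absoluteGaloisGroup K) [Fact (κ.IsTopGenerator γ)]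
    (Sf : Finset (HeightOneSpectrum (𝓞 K)))
    (hp2 : 2 < p) (hmult : Mult W p) (hns : ¬ W.HasSplitMultiplicativeReductionAtPrime p) (hred : Red W p)
    (hK : IsImaginaryQuadratic K) (hH : SatisfiesHeegnerHypothesis (W.conductorNorm ℤ) K)
    (hsplit : ((Ideal.span {(p : ℤ)}).primesOver (𝓞 K)).ncard = 2)
    (hv : ((p : ℕ) : 𝓞 K) ∈ v.asIdeal) (hvbar : ((p : ℕ) : 𝓞 K) ∈ vbar.asIdeal) (hne : vbar ≠ v) (hκ : κ.IsAnticyclotomic)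
    (hSf : ∀ w : HeightOneSpectrum (𝓞 K), w ∈ Sf ↔
      (((W.conductorNorm ℤ : ℤ) : 𝓞 K) ∈ w.asIdeal ∧ ((p : ℕ) : 𝓞 K) ∉ w.asIdeal))
    (θsub θquot : FramedGaloisRep K (padicCoeffIntegers (∅ : Set (PadicAlgCl p))) 1)
    (hpair : IsResidualPairOver (W.baseChange K) p θsub θquot)
    (D0sub : GrDualData κ (charModule (∅ : Set (PadicAlgCl p)) θsub) vbar (∅ : Set (HeightOneSpectrum (𝓞 K))) γ)
    (D0quot : GrDualData κ (charModule (∅ : Set (PadicAlgCl p)) θquot) vbar (∅ : Set (HeightOneSpectrum (𝓞 K))) γ) :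
    lambdaInvariant p (XAc (W.baseChange K) p κ vbar (↑Sf : Set (HeightOneSpectrum (𝓞 K))) γ) =
      lambdaInvariant p D0sub.X + lambdaInvariant p D0quot.X +
        ∑ w ∈ Sf, (charLocalLambda (∅ : Set (PadicAlgCl p)) κ θsub w + charLocalLambda (∅ : Set (PadicAlgCl p)) κ θquot w) := by
  obtain ⟨Dsub⟩ := nonempty_grDualData_char (∅ : Set (PadicAlgCl p)) θsub κ vbar (↑Sf : Set (HeightOneSpectrum (𝓞 K)))
    (Fact.out : κ.IsTopGenerator γ)
  obtain ⟨Dquot⟩ := nonempty_grDualData_char (∅ : Set (PadicAlgCl p)) θquot κ vbar (↑Sf : Set (HeightOneSpectrum (𝓞 K)))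
    (Fact.out : κ.IsTopGenerator γ)
  have halg := XAcImprimitiveNoPTorsion.lambdaInvariant_xAc_eq_add_of_not_split_of_facts hprop125 hfact hlift hlocal h411 h41 h42
    h32 W K vbar κ γ Sf hp2 hmult hns hred hK hH hsplit hv hvbar hne hκ hSf θsub θquot hpair Dsub Dquot
  have hsub := charLambdaRelaxation_eq_of_not_split_of_facts hprop125 hge W K vbar κ γ Sf hp2 hmult hns hK hH hsplit hvbar hκ hSf
    θsub θquot hpair θsub (Or.inl rfl) Dsub D0sub
  have hquot := charLambdaRelaxation_eq_of_not_split_of_facts hprop125 hge W K vbar κ γ Sf hp2 hmult hns hK hH hsplit hvbar hκ hSf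
    θsub θquot hpair θquot (Or.inr rfl) Dquot D0quot
  rw [halg, hsub, hquot, Finset.sum_add_distrib]
  ring

end Character

end Summit.BirchSwinnertonDyer.BirchSwinnertonDyer.Theorems.GrSelmerQuotientCorankLe

end
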